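import Summits.SmoothPoincare4.SmoothPoincare4.Theorems.SymplecticOrigamiOrigamiFoldExistenceStubOuterCleanRecognitionOfSidePsiCover
import Summits.SmoothPoincare4.SmoothPoincare4.Theorems.SymplecticOrigamiOrigamiFoldExistenceStubOuterCleanRecognitionChartCutRegion
import Summits.SmoothPoincare4.SmoothPoincare4.Theorems.SymplecticOrigamiOrigamiFoldExistenceStubOuterCleanRecognitionChartInverseExtension
import Summits.SmoothPoincare4.SmoothPoincare4.Theorems.SymplecticOrigamiOrigamiFoldExistenceShadowPleatsOuterCleanDefs
import Literature.Topology.FourManifolds.CerfGammaFourProofs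
import Mathlib.Analysis.Normed.Module.Ball.Pointwise

/-!
# Stub `stub_outerCleanRecognitionOfSide` of line `shadow-pleats` for crux `OrigamiFoldExistence` — S:
# OUTER-CLEAN RECOGNITION, the assembly (item stmt-SmoothPoincare4-7844, route SymplecticOrigami; seat c5, lead)

The registered stub S4''σ of skeleton r8/r9 (`Cruxes/OrigamiFoldExistence/Lines/shadow_pleats.lean`):
`OuterSideLemma → Schoenflies → CerfGammaFour → ∀ M ≃ₕ S⁴, HasOuterCleanPleatedPosition M 1 → M ≅ S⁴`, by the CUT-AT-`R`
construction of seat c4's r8 design over: the glue `nonempty_diffeomorph_of_chartComplement` (p118158); collar data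
(`nonempty_collarData`, file F, fed with the side lemma); the cut region `U_R = liftedCut D R` and its topology (file P1);
the connected cut exterior (file P2); the structure map `Ψ = psiMap ι δ (capMap δ)` (files Q, N, O′), INJECTIVE on
`K = M ∖ e₀(B₂)` with image `(chimney)ᶜ` (file Σ `…PsiCover`, by coverings — no sheet count) and immersive off the fold
spheres (`injective_mfderiv_psiMap`); the globally smooth left inverse `Φ` near `K_R = M ∖ e₀(B_R)` (file R).  With
`R = 2 + 3κ/4` inside the thin fold-free collar of width `κ`: `Ψ(K_R) = U_Rᶜ`; the rescaled chart `e₀ ∘ (R/2 ·)` and the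
rescaled lifted crease `u ↦ λ(G((R/2) u))` (an EMBEDDED sphere at radius `R`, where the shadow does not fold) feed the
glue together with `U_R` and `Φ`.

* `stub_outerCleanRecognitionOfSide` — THE REGISTERED STUB, verbatim.

Sources: the r8 docstring of `stub_outerCleanRecognitionOfSide` (seat c4); `OuterClean-analysis-c3.md` §§2–4.
-/

noncomputable section

-- the prescribed namespace `Summit.<P>.<Sub>.…` duplicates `SmoothPoincare4` (P = Sub)
set_option linter.dupNamespace false

open scoped Manifold ContDiff Topology RealInnerProductSpace Pointwise
open Set Function Filter Metric
open Literature.Topology.FourManifolds Literature.Topology.FourManifolds.SphereHypersurfaceSides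

namespace Summit.SmoothPoincare4.SmoothPoincare4.Theorems.OrigamiFoldExistence.ShadowPleats

section Assembly

open ContinuousMap

variable {M : Type} [TopologicalSpace M] [T2Space M] [SecondCountableTopology M]
  [ChartedSpace (EuclideanSpace ℝ (Fin 4)) M] [IsManifold (𝓡 4) ∞ M]

omit [T2Space M] [SecondCountableTopology M] [IsManifold (𝓡 4) ∞ M] in
/-- Rescaling a smooth embedding `e₀ : ℝ⁴ ↪ M` by a non-zero factor gives a smooth embedding (precomposition with the
dilation diffeomorphism `u ↦ a • u`). -/
theorem isSmoothEmbedding_comp_smul {e₀ : EuclideanSpace ℝ (Fin 4) → M}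
    (he : Manifold.IsSmoothEmbedding (𝓡 4) (𝓡 4) ∞ e₀) {a : ℝ} (ha : a ≠ 0) :
    Manifold.IsSmoothEmbedding (𝓡 4) (𝓡 4) ∞ (e₀ ∘ fun u : EuclideanSpace ℝ (Fin 4) => a • u) :=
  he.comp_diffeomorph
    ((ContinuousLinearEquiv.smulLeft (Units.mk0 a ha) :
      EuclideanSpace ℝ (Fin 4) ≃L[ℝ] EuclideanSpace ℝ (Fin 4)).toDiffeomorph)

/-- Chain rule for precomposition with a dilation: `d(G ∘ (a ·))_u w = dG_{a u} (a w)`. -/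
theorem fderiv_comp_smul {G : EuclideanSpace ℝ (Fin 4) → EuclideanSpace ℝ (Fin 4)} (hG : ContDiff ℝ ∞ G) (a : ℝ)
    (u w : EuclideanSpace ℝ (Fin 4)) :
    fderiv ℝ (G ∘ fun v : EuclideanSpace ℝ (Fin 4) => a • v) u w = fderiv ℝ G (a • u) (a • w) := by
  have h1 : HasFDerivAt (fun v : EuclideanSpace ℝ (Fin 4) => a • v)
      (a • ContinuousLinearMap.id ℝ (EuclideanSpace ℝ (Fin 4))) u := (hasFDerivAt_id u).const_smul a
  have h2 : HasFDerivAt G (fderiv ℝ G (a • u)) (a • u) :=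
    ((hG.differentiable (by simp)).differentiableAt).hasFDerivAt
  rw [(h2.comp u h1).fderiv]
  rfl

/-- **STUB S4''σ [OUTER-CLEAN RECOGNITION GIVEN THE SIDE LEMMA]** — the registered stub of skeleton r8/r9 of the line
`shadow-pleats`, verbatim: given O1, smooth 4-dimensional Schoenflies and Cerf's `Γ₄ = 0` (the two route items, by name),
a homotopy `4`-sphere with an OUTER-CLEAN `1`-pleat round-rim position is diffeomorphic to `S⁴`.  (O1 is itself a tree
theorem, `stub_outerSideLemma`; the hypothesis is kept because it is the registered signature.) [folklore] -/
theorem stub_outerCleanRecognitionOfSide : OuterSideLemma →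
    Summit.SmoothPoincare4.SmoothPoincare4.Theses.EuclideanOrigami.Schoenflies →
    Summit.SmoothPoincare4.SmoothPoincare4.Theses.SymplecticOrigami.CerfGammaFour →
    ∀ (M : Type) [TopologicalSpace M] [T2Space M] [SecondCountableTopology M]
      [ChartedSpace (EuclideanSpace ℝ (Fin 4)) M] [IsManifold (𝓡 4) ∞ M],
      M ≃ₕ (Metric.sphere (0 : EuclideanSpace ℝ (Fin 5)) 1) →
      HasOuterCleanPleatedPosition M 1 →
      Nonempty (M ≃ₘ⟮𝓡 4, 𝓡 4⟯ (Metric.sphere (0 : EuclideanSpace ℝ (Fin 5)) 1)) := by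
  intro hO hS hC M _ _ _ _ _ hM hP
  classical
  haveI : CompactSpace M := compactSpace_of_homotopyEquiv_sphere_four_holds M hM
  haveI : SimplyConnectedSpace M :=
    simplyConnectedSpace_of_homotopyEquiv_sphere_four simplyConnectedSpace_sphere_four_holds M hM
  obtain ⟨ι, δ, e, hpos, hclean⟩ := (hasOuterCleanPleatedPosition_one_iff M).1 hP
  have hclean' : Set.InjOn (proj5 ∘ ι ∘ e 0) (Metric.sphere 0 2) := hclean
  have hpos' := hpos
  obtain ⟨hι, hδ, hδ1, hround, hcharts, -, himm, -⟩ := hpos'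
  have he : Manifold.IsSmoothEmbedding (𝓡 4) (𝓡 4) ∞ (e 0) := (hcharts 0).1
  have heinj : Injective (e 0) := he.isEmbedding.injective
  have heopen : IsOpenMap (e 0) := isOpenMap_pleatChart he
  have habove : ∀ v, 1 - δ < ι (e 0 v) 4 := (hcharts 0).2
  haveI : Nonempty M := ⟨e 0 0⟩
  set G : EuclideanSpace ℝ (Fin 4) → EuclideanSpace ℝ (Fin 4) := proj5 ∘ ι ∘ e 0 with hGdef
  have hG : ContDiff ℝ ∞ G := contDiff_chartShadow hpos
  have hf := isSmoothEmbedding_liftedCrease hpos hclean'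
  obtain ⟨D⟩ := nonempty_tubeData hf
  obtain ⟨cd⟩ := nonempty_collarData hO hM hpos hclean' D
  -- the cut radius `R = 2 + 3κ/4`
  set κ : ℝ := cd.h.κ with hκdef
  have hκ : 0 < κ := cd.h.pos
  set R : ℝ := 2 + 3 * κ / 4 with hRdef
  have hR : 2 + cd.h.κ / 2 < R := by rw [hRdef]; show 2 + κ / 2 < 2 + 3 * κ / 4; linarith
  have hRκ : R < 2 + cd.h.κ := by rw [hRdef]; show 2 + 3 * κ / 4 < 2 + κ; linarith
  have hR2 : 2 < R := by rw [hRdef]; linarith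
  /- ### the structure map with the tree's cap map -/
  have hCs : ∀ p : EuclideanSpace ℝ (Fin 5), p 4 < 1 →
      ContMDiffAt 𝓘(ℝ, EuclideanSpace ℝ (Fin 5)) (𝓡 4) ∞ (capMap δ) p := fun _ hp => contMDiffAt_capMap hδ1 hp
  have hCband : ∀ p : EuclideanSpace ℝ (Fin 5), ‖p‖ = 1 → (1 - δ) / 2 ≤ p 4 → p 4 < 1 →
      capMap δ p = liftS4 (proj5 p) := fun _ hp1 hb hp4 => capMap_eq_liftS4_proj5 hδ1 hp1 hp4 hb
  have hCd : ∀ p : EuclideanSpace ℝ (Fin 5), ‖p‖ = 1 → p 4 ≤ 1 - δ → ∀ w : EuclideanSpace ℝ (Fin 5),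
      ⟪p, w⟫ = 0 → mfderiv 𝓘(ℝ, EuclideanSpace ℝ (Fin 5)) (𝓡 4) (capMap δ) p w = 0 → w = 0 :=
    fun _ hp1 hp4 _ hpw h0 => eq_zero_of_mfderiv_capMap_eq_zero hδ hδ1 hp1 hp4 hpw h0
  set Ψ : M → Metric.sphere (0 : EuclideanSpace ℝ (Fin 5)) 1 := psiMap ι δ (capMap δ) with hΨdef
  have hΨsmooth : ContMDiff (𝓡 4) (𝓡 4) ∞ Ψ := contMDiff_psiMap hι hδ hδ1 hround hCs hCband
  have hΨe : ∀ v, Ψ (e 0 v) = liftS4 (G v) := fun v => psiMap_of_lt (habove v)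
  obtain ⟨hinjK, himK⟩ := injOn_and_image_psiMap_capMap hpos hclean' D
  rw [← hΨdef] at hinjK himK
  /- ### the compact piece `K_R = M ∖ e₀(B_R)` -/
  set KR : Set M := {m | m ∉ e 0 '' Metric.ball 0 R} with hKRdef
  have hKRK : KR ⊆ {m : M | m ∉ e 0 '' Metric.ball 0 2} := fun m hm h =>
    hm (image_mono (Metric.ball_subset_ball hR2.le) h)
  have hKRcpt : IsCompact KR := (heopen _ isOpen_ball).isClosed_compl.isCompact
  have heK : ∀ v : EuclideanSpace ℝ (Fin 4), 2 ≤ ‖v‖ → e 0 v ∈ {m : M | m ∉ e 0 '' Metric.ball 0 2} := by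
    rintro v hv ⟨v', hv', hvv'⟩
    rw [heinj hvv'] at hv'
    exact absurd (mem_ball_zero_iff.1 hv') (not_lt.2 hv)
  have heKR : ∀ v : EuclideanSpace ℝ (Fin 4), R ≤ ‖v‖ → e 0 v ∈ KR := by
    rintro v hv ⟨v', hv', hvv'⟩
    rw [heinj hvv'] at hv'
    exact absurd (mem_ball_zero_iff.1 hv') (not_lt.2 hv)
  have hinjKR : InjOn Ψ KR := hinjK.mono hKRK
  -- immersivity on `K_R`: off `e₀(B_R)` there are no fold spheres
  have hfold : ∀ m : M, 1 - δ < ι m 4 → m ∉ e 0 '' Metric.ball 0 R →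
      Injective (mfderiv (𝓡 4) (𝓡 4) (proj5 ∘ ι) m) := by
    intro m hm hmR
    refine himm m hm ?_
    rintro ⟨_, ⟨j, rfl⟩, ⟨u, hu, rfl⟩⟩
    have hj : j = 0 := Subsingleton.elim j 0
    subst hj
    refine hmR ⟨u, mem_ball_zero_iff.2 ?_, rfl⟩
    rcases hu with h1 | h2
    · rw [mem_sphere_zero_iff_norm.1 h1]; linarith
    · rw [mem_sphere_zero_iff_norm.1 h2]; exact hR2
  have hdKR : ∀ m ∈ KR, Injective (mfderiv (𝓡 4) (𝓡 4) Ψ m) := fun m hm =>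
    injective_mfderiv_psiMap hι hδ hδ1 hround hCs hCband hCd hfold hm
  /- ### the smooth left inverse `Φ` (file R) -/
  obtain ⟨W, hWo, hKW, hinjW, hdW⟩ := exists_isOpen_injOn_bijective_mfderiv hΨsmooth hKRcpt hinjKR hdKR
  have hcov : KRᶜ ⊆ range (e 0) := by
    intro m hm
    simp only [hKRdef, mem_compl_iff, mem_setOf_eq, not_not] at hm
    obtain ⟨u, -, rfl⟩ := hm
    exact mem_range_self u
  obtain ⟨Φ, hΦ, ⟨W', -, hKW', -, hΦΨ⟩, hΦi, hΦd, hΦim⟩ :=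
    exists_contMDiff_leftInverse hΨsmooth hKRcpt hWo hKW hinjW hdW he hcov
  /- ### `Ψ(K_R)` is the complement of the cut region -/
  have himKR : Ψ '' KR = (liftedCut D R)ᶜ := by
    apply Subset.antisymm
    · rintro _ ⟨m, hm, rfl⟩ hz
      rcases hz with hch | ⟨u, ⟨hu2, huR⟩, hzu⟩
      · have : Ψ m ∈ (chimney D)ᶜ := himK ▸ ⟨m, hKRK hm, rfl⟩
        exact this hch
      · have heq : e 0 u = m := hinjK (heK u hu2) (hKRK hm) (by rw [hΨe]; exact hzu)
        exact hm ⟨u, mem_ball_zero_iff.2 huR, heq⟩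
    · intro z hz
      have hz' : z ∈ (chimney D)ᶜ := fun h => hz (Or.inl h)
      rw [← himK] at hz'
      obtain ⟨m, hmK, rfl⟩ := hz'
      refine ⟨m, ?_, rfl⟩
      rintro ⟨u, hu, rfl⟩
      have hu2 : 2 ≤ ‖u‖ := by
        by_contra hlt
        exact hmK ⟨u, mem_ball_zero_iff.2 (not_le.1 hlt), rfl⟩
      exact hz (Or.inr ⟨u, ⟨hu2, mem_ball_zero_iff.1 hu⟩, (hΨe u).symm⟩)
  /- ### the rescaled chart and the rescaled lifted crease at radius `R` -/
  set a : ℝ := R / 2 with hadef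
  have ha : a ≠ 0 := by rw [hadef]; positivity
  have ha0 : 0 < a := by rw [hadef]; positivity
  have hnorm_a : ∀ u : EuclideanSpace ℝ (Fin 4), ‖a • u‖ = a * ‖u‖ := fun u => by
    rw [norm_smul, Real.norm_of_nonneg ha0.le]
  have haR : a * 2 = R := by rw [hadef]; ring
  set e₀' : EuclideanSpace ℝ (Fin 4) → M := e 0 ∘ fun u => a • u with he₀'
  have he' : Manifold.IsSmoothEmbedding (𝓡 4) (𝓡 4) ∞ e₀' := isSmoothEmbedding_comp_smul he ha
  set c : EuclideanSpace ℝ (Fin 4) → Metric.sphere (0 : EuclideanSpace ℝ (Fin 5)) 1 :=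
    fun u => liftS4 (G (a • u)) with hcdef
  -- the rescaled shadow `G ∘ (a ·)` is injective on `S(0,2)` with injective differential there (no fold at radius `R`)
  have hG' : ContDiff ℝ ∞ (G ∘ fun u : EuclideanSpace ℝ (Fin 4) => a • u) := hG.comp (contDiff_id.const_smul a)
  have hmemR : ∀ u : EuclideanSpace ℝ (Fin 4), ‖u‖ = 2 → 2 < ‖a • u‖ ∧ ‖a • u‖ < 2 + cd.h.κ := fun u hu => by
    rw [hnorm_a, hu, hadef]
    constructor <;> linarith
  have hinj' : InjOn (G ∘ fun u : EuclideanSpace ℝ (Fin 4) => a • u) (Metric.sphere 0 2) := by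
    intro u hu v hv huv
    have hu' := hmemR u (mem_sphere_zero_iff_norm.1 hu)
    have hv' := hmemR v (mem_sphere_zero_iff_norm.1 hv)
    have := cd.injOn ⟨hu'.1.le, hu'.2⟩ ⟨hv'.1.le, hv'.2⟩ huv
    exact smul_right_injective _ ha this
  have hker' : ∀ u w : EuclideanSpace ℝ (Fin 4), ‖u‖ = 2 → ⟪u, w⟫ = 0 →
      fderiv ℝ (G ∘ fun v : EuclideanSpace ℝ (Fin 4) => a • v) u w = 0 → w = 0 := by
    intro u w hu _ hw
    rw [fderiv_comp_smul hG] at hw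
    have hu' := hmemR u hu
    have := cd.immersive (a • u) hu'.1 hu'.2
      (show fderiv ℝ G (a • u) (a • w) = fderiv ℝ G (a • u) 0 by rw [hw, map_zero])
    exact smul_right_injective _ ha (this.trans (smul_zero a).symm)
  have hf' : Manifold.IsSmoothEmbedding (𝓡 3) (𝓡 4) ∞
      (fun z : Metric.sphere (0 : EuclideanSpace ℝ (Fin 4)) 1 => c ((2 : ℝ) • (z : EuclideanSpace ℝ (Fin 4)))) := by
    have heq : (fun z : Metric.sphere (0 : EuclideanSpace ℝ (Fin 4)) 1 => c ((2 : ℝ) • (z : EuclideanSpace ℝ (Fin 4)))) =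
        liftS4 ∘ radialSphere (G ∘ fun u : EuclideanSpace ℝ (Fin 4) => a • u) 2 := by
      funext z; rfl
    rw [heq]
    exact isSmoothEmbedding_liftS4_radialSphere hG' hinj' hker'
  /- ### the cut region -/
  have hN : northPole ∉ range (liftedCrease ι (e 0)) := northPole_notMem_range_liftedCrease ι (e 0)
  set U : Set (Metric.sphere (0 : EuclideanSpace ℝ (Fin 5)) 1) := liftedCut D R with hUdef
  have hUo : IsOpen U := isOpen_liftedCut hpos cd hR hRκ
  have hUc : IsConnected U := isConnected_liftedCut hpos cd hR
  have hXc : IsConnected (closure U)ᶜ := by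
    rw [hUdef, compl_closure_liftedCut hpos cd hR]
    exact isConnected_exterior_diff_cutCollar hpos cd hR2 hRκ
  have himage_c : c '' Metric.sphere 0 2 = (liftS4 ∘ proj5 ∘ ι ∘ e 0) '' Metric.sphere 0 R := by
    have h1 : c = (liftS4 ∘ proj5 ∘ ι ∘ e 0) ∘ fun u : EuclideanSpace ℝ (Fin 4) => a • u := by
      funext u; rfl
    rw [h1, image_comp, image_smul, smul_sphere' ha, smul_zero, Real.norm_of_nonneg ha0.le, haR]
  have hfr : frontier U = c '' Metric.sphere 0 2 := by
    rw [hUdef, frontier_liftedCut hpos cd hR hRκ, himage_c]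
  /- ### the hypotheses on `Φ` -/
  have hΦi' : InjOn Φ Uᶜ := by rw [hUdef, ← himKR]; exact hΦi
  have hΦd' : ∀ x ∈ Uᶜ, Injective (mfderiv (𝓡 4) (𝓡 4) Φ x) := by rw [hUdef, ← himKR]; exact hΦd
  have hball : e₀' '' Metric.ball 0 2 = e 0 '' Metric.ball 0 R := by
    rw [he₀', image_comp, image_smul, _root_.smul_ball ha, smul_zero, Real.norm_of_nonneg ha0.le, haR]
  have hΦU : Φ '' Uᶜ = (e₀' '' Metric.ball 0 2)ᶜ := by
    rw [hUdef, ← himKR, hΦim, hball, hKRdef]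
    rfl
  have hΦc : ∀ u ∈ Metric.sphere (0 : EuclideanSpace ℝ (Fin 4)) 2, Φ (c u) = e₀' u := by
    intro u hu
    have hu2 := mem_sphere_zero_iff_norm.1 hu
    have hmem : e 0 (a • u) ∈ KR := heKR _ (by rw [hnorm_a, hu2, hadef]; linarith)
    show Φ (liftS4 (G (a • u))) = e 0 (a • u)
    rw [← hΨe]
    exact hΦΨ _ (hKW' hmem)
  /- ### glue -/
  exact nonempty_diffeomorph_of_chartComplement hS hC he' hf' hUo hUc hXc hfr hΦ hΦi' hΦd' hΦU hΦc

end Assembly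

end Summit.SmoothPoincare4.SmoothPoincare4.Theorems.OrigamiFoldExistence.ShadowPleats

end
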